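import Summits.QuantumFields.YangMills.Theorems.ParabolicTrajectoryContinuumLimitOnTrajectoryDefsG

/-!
# Crux `ContinuumLimitExists` (stmt-QuantumFields-16124), line `birth`: the ∃-stub `stub_uvScheme` through the
# two-orbit supplier (route `ParabolicTrajectory`) — SUPPLIER GLUE, kernel-checked, gap-free

Crux workfile of the line lead `prover-line-stmt-QuantumFields-16124-0` (cycle 1). The registered ∃-stub of
`Lines/birth.lean`,

  `stub_uvScheme : ∀ G compact simple, ∃ r sch, β_k → ∞ ∧ PolyVolumeGrowth sch ∧ ConvProducts r sch ∧ UUVB r sch ∧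
     ND2 r sch ∧ ND3 r sch`,

is deliberately supplier-agnostic (the constructive heart: a weak-coupling Wilson sequence along which the canonically
renormalised `tr F²` functions converge on products, with uniform plaquette-string bounds and non-degenerate 2- and
3-point limits). This file proves, WITHOUT touching the registered skeleton, what the stub becomes for the ONE supplier
whose soft content is landed in the tree — the two-orbit synchronisation line of the sibling crux
`ContinuumLimitOnTrajectory` (route `ParabolicTrajectory`; `…ContinuumLimitOnTrajectory{Defs,…,DefsG,Reduction,Reduction2,
ReductionPVG}`):

* `convProducts_of_chart` — the synchronisation engine ISOLATED and GAP-FREE: for a chart `𝒞 : TwoOrbitChart G r M`, every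
  tuned `M`-adic Wilson sequence (`θ > 0`, `β_k → ∞`, convergent scaled point-split towers) satisfying the rate-free
  finite-size clause `QualFiniteSize r M sch n` has `ConvProducts r sch`. This is lines 70–200 of the landed
  `Reduction.reductionCS` (p139780/p141887) with the chart as an explicit argument and NO `HasLatticeMassGap` / `IRPhysicsCS`
  / `VolumeClause` hypothesis: the sibling leads' finding that the gap hypothesis (ii) of (A) is IDLE in the convergence
  argument, made a theorem.
* `QualFiniteSizeInput`, `UVEngine345` — the GAP-FREE twins of the sibling inputs (`IRPhysicsCS`'s finite-size conjunct,
  `UVPhysics345`), i.e. the same statements with the idle antecedents `0 < Δ`, `HasLatticeMassGap r sch Δ` deleted; they are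
  STRONGER statements (more sequences), so one proof serves both routes (`uvPhysics345_of_uvEngine345`).
* `uvScheme345_of_twoOrbit : TunedSequenceExistsPVG → ChartExists → QualFiniteSizeInput → UVEngine345 → UVScheme345`, where
  `UVScheme345` is the statement of `stub_uvScheme` with `Rot345 r sch` added (so it ALSO discharges the v3 stub
  `stub_rotation345` for the witness sequence), and `stub_uvScheme_of_twoOrbit` (drop `Rot345`).

Reading: modulo kernel-checked glue, `stub_uvScheme` (+ `stub_rotation345` on its witness) = (S_PVG) `TunedSequenceExistsPVG`
(= the restated item (S) of route ParabolicTrajectory, `…DefsG`) ∧ `ChartExists` (Bałaban's complete RG step as a Lipschitz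
two-orbit chart — PROMOTED to item size by that crux's lead, `Cruxes/ContinuumLimitOnTrajectory/PROMOTE-…md`) ∧ the
volume-uniform UV engine `UVEngine345` (UUVB ∧ Rot345 ∧ ND2 ∧ ND3 — the statement the leads of stmt-10522 and stmt-15828 ask
the planner to file ONCE as a shared item) ∧ the rate-free thermodynamic limit at scale `QualFiniteSizeInput`. Each is an
item's worth of open mathematics; none is a stub a worker can close. Nothing here is asserted: every input is an explicit
antecedent. Refs: `…Reduction2` (reductionCS), `…DefsE/F/G`; Balaban1988Convergent; OsterwalderSeiler1978 §§2–4.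
-/

set_option autoImplicit false

open scoped SchwartzMap
open MeasureTheory Filter Topology
open Literature.MathematicalPhysics.QuantumFieldTheory Literature.MathematicalPhysics.QuantumLattice
open Literature.MathematicalPhysics.AQFT Literature.Probability.LatticeModels
open Summit.QuantumFields.YangMills.Cruxes.ContinuumLimitOnTrajectory.TwoOrbitSynchronisation

noncomputable section

namespace Summit.QuantumFields.YangMills.Cruxes.ContinuumLimitExists.Birth

local notation "𝔼" => EuclideanSpace ℝ (Fin 4)

/-! ## §1 The synchronisation engine, isolated and gap-free -/

section Engine

variable {G : Type} [Group G] [TopologicalSpace G] [IsTopologicalGroup G] [CompactSpace G]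
  [MeasurableSpace G] [BorelSpace G]

/-- **`ConvProducts` from a two-orbit chart (gap-free).** Given a chart `𝒞 : TwoOrbitChart G r M`, a tuned `M`-adic Wilson
sequence — `a_k = M^{-n_k}`, `β_k → ∞`, convergent scaled point-split towers `(M^{n_k})⁸⟨P;τ_{tM^{n_k}}P⟩ → c_t`, tuning
`… → θ > 0` at `t = 1` — that satisfies the rate-free finite-size clause `QualFiniteSize r M sch n` has full-sequence
convergence of every canonical curvature `p`-point function on off-diagonal real product tensors. Proof = the landed
`Reduction.reductionCS` body: synchronisation constants (`stub_sync`), sub-window `γ'`, Wilson couplings `g_k` from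
`betaOf_surj`, infinite-volume towers (`QualFiniteSize` (b) + `corr_tendsto`), `stub_anatomy`, the pin, `Reduction.pair_bound`
⇒ the terminal chart points are Cauchy ⇒ limit point in the closed window ⇒ convergence by `continuousOn_expect`, the RG
covariance `expect_iterate`, `expect_wilson` and `QualFiniteSize` (a). No mass-gap hypothesis occurs. -/
theorem convProducts_of_chart (r : LatticeRep G) {M : ℕ} (𝒞 : TwoOrbitChart G r M) {θ : ℝ}
    {sch : SpeciesScheme (YMSpecies G)} {n : ℕ → ℕ} (hθ : 0 < θ) (hshape : ∀ k, sch.a k = ((M : ℝ) ^ n k)⁻¹)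
    (hβ : Tendsto sch.β atTop atTop)
    (htower : ∀ t : ℕ, 0 < t → ∃ c : ℝ, Tendsto (fun k => ((M : ℝ) ^ n k) ^ 8 *
      latticeConnectedCorr r.ρ (sch.β k) (sch.side k) r.curvature.F r.curvature.F (t * M ^ n k)) atTop (𝓝 c))
    (htune : Tendsto (fun k => ((M : ℝ) ^ n k) ^ 8 *
      latticeConnectedCorr r.ρ (sch.β k) (sch.side k) r.curvature.F r.curvature.F (M ^ n k)) atTop (𝓝 θ))
    (hvol' : QualFiniteSize r M sch n) : ConvProducts r sch := by
  /- constants, independent of the tuning -/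
  set κ₀ : ℝ := (1 - 𝒞.θ') / 2 with hκ₀_def
  have h1θ : 0 < 1 - 𝒞.θ' := by linarith [𝒞.θ'_lt_one]
  have hκ₀pos : 0 < κ₀ := by rw [hκ₀_def]; positivity
  have hdom : 𝒞.θ' * (1 + κ₀) < 1 := by
    rw [hκ₀_def]; nlinarith [𝒞.θ'_nonneg, 𝒞.θ'_lt_one, h1θ]
  obtain ⟨ε₀, K, θ₁, hε₀, hK, hθ₁0, hθ₁1, hS⟩ := stub_sync 𝒞.θ' κ₀ 𝒞.θ'_nonneg hκ₀pos.le hdom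
  -- the sub-window γ'
  have hev : ∀ᶠ x in 𝓝[>] (0 : ℝ), (0 < x ∧ x ≤ 𝒞.γ) ∧ 𝒞.Cκ * x ^ 2 ≤ κ₀ ∧
      𝒞.C₁ * (𝒞.C₃ * x ^ 3) ≤ ε₀ ∧ 8 * 𝒞.b * x ^ 2 ≤ 1 ∧ K * 𝒞.C₁ * (𝒞.ℓ₀ * x) ≤ 1 / 2 := by
    have hIoc : ∀ᶠ x in 𝓝[>] (0 : ℝ), 0 < x ∧ x ≤ 𝒞.γ := by
      filter_upwards [Ioo_mem_nhdsGT 𝒞.γ_pos] with x hx using ⟨hx.1, hx.2.le⟩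
    have hcts : ∀ (c : ℝ) {p : ℕ}, 0 < p → Tendsto (fun x : ℝ => c * x ^ p) (𝓝[>] 0) (𝓝 0) := by
      intro c p hp
      have hc : Continuous (fun x : ℝ => c * x ^ p) := by fun_prop
      have h := (hc.tendsto (0 : ℝ)).mono_left (nhdsWithin_le_nhds (s := Set.Ioi (0 : ℝ)))
      simpa [zero_pow hp.ne'] using h
    have h1 : ∀ᶠ x in 𝓝[>] (0 : ℝ), 𝒞.Cκ * x ^ 2 ≤ κ₀ := (hcts 𝒞.Cκ two_pos).eventually_le_const hκ₀pos
    have h2 : ∀ᶠ x in 𝓝[>] (0 : ℝ), 𝒞.C₁ * (𝒞.C₃ * x ^ 3) ≤ ε₀ :=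
      ((hcts (𝒞.C₁ * 𝒞.C₃) three_pos).eventually_le_const hε₀).mono fun x hx => by
        simpa only [mul_assoc] using hx
    have h3 : ∀ᶠ x in 𝓝[>] (0 : ℝ), 8 * 𝒞.b * x ^ 2 ≤ 1 :=
      (hcts (8 * 𝒞.b) two_pos).eventually_le_const one_pos
    have h4 : ∀ᶠ x in 𝓝[>] (0 : ℝ), K * 𝒞.C₁ * (𝒞.ℓ₀ * x) ≤ 1 / 2 :=
      ((hcts (K * 𝒞.C₁ * 𝒞.ℓ₀) one_pos).eventually_le_const (u := 1 / 2) (by norm_num)).mono fun x hx => by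
        simpa only [mul_assoc, pow_one] using hx
    exact hIoc.and (h1.and (h2.and (h3.and h4)))
  obtain ⟨γ', ⟨hγ'pos, hγ'le⟩, hκle, hprod, h8b, hsmall⟩ := hev.exists
  -- the synchronisation constants at (κ, c₁, c₃) = (Cκ γ'², C₁, C₃ γ'³)
  have hSk := hS (𝒞.Cκ * γ' ^ 2) 𝒞.C₁ (𝒞.C₃ * γ' ^ 3) (by have := 𝒞.Cκ_nonneg; positivity) hκle
    𝒞.C₁_nonneg (by have := 𝒞.C₃_nonneg; positivity) hprod
  -- Wilson couplings (uses β_k → ∞)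
  classical
  let g : ℕ → ℝ := fun k => if h : 𝒞.B₀ ≤ sch.β k then (𝒞.betaOf_surj (sch.β k) h).choose else 𝒞.g₀
  have hgk : ∀ᶠ k in atTop, g k ∈ Set.Ioc (0 : ℝ) 𝒞.g₀ ∧ 𝒞.betaOf (g k) = sch.β k := by
    filter_upwards [hβ.eventually_ge_atTop 𝒞.B₀] with k hk
    simp only [g, dif_pos hk]
    exact (𝒞.betaOf_surj (sch.β k) hk).choose_spec
  have hgβ : Tendsto (fun k => 𝒞.betaOf (g k)) atTop atTop :=
    hβ.congr' (hgk.mono fun k hk => hk.2.symm)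
  have hn : Tendsto n atTop atTop :=
    Summit.QuantumFields.YangMills.Theorems.LatticeGapOnTrajectory.Negative.tendsto_n_of_shape sch hshape
  -- infinite-volume towers (QualFiniteSize (b) + corr_tendsto)
  have hclose : ∀ t : ℕ, 0 < t → ∀ ε : ℝ, 0 < ε → ∀ᶠ k in atTop,
      |((M : ℝ) ^ n k) ^ 8 *
          latticeConnectedCorr r.ρ (sch.β k) (sch.side k) r.curvature.F r.curvature.F (t * M ^ n k) -
        ((M : ℝ) ^ n k) ^ 8 * 𝒞.corrInf (g k) (t * M ^ n k)| ≤ ε := by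
    intro t ht ε hε
    filter_upwards [hvol'.2 t ht ε hε, hgk] with k hk hg'
    have hT := 𝒞.corr_tendsto (g k) hg'.1 (t * M ^ n k)
    rw [hg'.2] at hT
    rw [← mul_sub, abs_mul, abs_of_nonneg (by positivity)]
    refine le_of_tendsto ((tendsto_const_nhds.sub hT).abs.const_mul _) (eventually_atTop.2 ⟨sch.L k, ?_⟩)
    intro S hS'
    exact hk S hS'
  have htowerInf : ∀ t : ℕ, 0 < t → ∃ c : ℝ,
      Tendsto (fun k => ((M : ℝ) ^ n k) ^ 8 * 𝒞.corrInf (g k) (t * M ^ n k)) atTop (𝓝 c) := by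
    intro t ht
    obtain ⟨c, hc⟩ := htower t ht
    exact ⟨c, tendsto_of_forall_eventually_abs_sub_le hc fun ε hε =>
      (hclose t ht ε hε).mono fun k hk => by rwa [abs_sub_comm] at hk⟩
  have htune1 : Tendsto (fun k => ((M : ℝ) ^ n k) ^ 8 * 𝒞.corrInf (g k) (M ^ n k)) atTop (𝓝 θ) := by
    have h := hclose 1 one_pos
    simp only [one_mul] at h
    exact tendsto_of_forall_eventually_abs_sub_le htune fun ε hε =>
      (h ε hε).mono fun k hk => by rwa [abs_sub_comm] at hk
  /- anatomy (uses θ > 0) -/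
  obtain ⟨m, g_low, J, hglow, hJ, hA⟩ :=
    stub_anatomy G r M 𝒞 γ' hγ'pos hγ'le h8b θ g n hθ (hgk.mono fun k hk => hk.1) hgβ hn htune1
  /- the pin and its readout sequence -/
  obtain ⟨t, ht, c_r, hc_r, η, hη, hpin⟩ := 𝒞.pin m g_low γ' hglow hγ'pos hγ'le
  obtain ⟨ct, hct⟩ := htowerInf t ht
  have hRd : Tendsto (fun k => 𝒞.Rd m t (g k) (J k)) atTop (𝓝 ct) := by
    refine hct.congr' ?_
    filter_upwards [hA] with k hk
    rw [TwoOrbitChart.Rd, hk.1]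
  /- the terminal chart points form a Cauchy sequence -/
  set q : ℕ → ℝ × 𝒞.E := fun k => 𝒞.orb (g k) (J k) with hq_def
  have hcauchy : CauchySeq q := by
    rw [cauchySeq_iff_tendsto_dist_atTop_0, ← prod_atTop_atTop_eq]
    have hmin : Tendsto (fun p : ℕ × ℕ => min (J p.1) (J p.2)) (atTop ×ˢ atTop) atTop :=
      tendsto_atTop.2 fun b => ((tendsto_atTop.1 (hJ.comp tendsto_fst) b).and
        (tendsto_atTop.1 (hJ.comp tendsto_snd) b)).mono fun p hp => le_min hp.1 hp.2
    have hD : Tendsto (fun p : ℕ × ℕ => |𝒞.Rd m t (g p.1) (J p.1) - 𝒞.Rd m t (g p.2) (J p.2)|)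
        (atTop ×ˢ atTop) (𝓝 0) := by
      have := ((hRd.comp tendsto_fst).sub (hRd.comp tendsto_snd)).abs
      simpa using this
    have hηp : Tendsto (fun p : ℕ × ℕ => |η (min (J p.1) (J p.2))|) (atTop ×ˢ atTop) (𝓝 0) := by
      simpa using (hη.comp hmin).abs
    have hP : Tendsto (fun p : ℕ × ℕ => θ₁ ^ (min (J p.1) (J p.2) - 𝒞.j₀)) (atTop ×ˢ atTop) (𝓝 0) :=
      (tendsto_pow_atTop_nhds_zero_of_lt_one hθ₁0 hθ₁1).comp ((tendsto_sub_atTop_nat 𝒞.j₀).comp hmin)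
    have hbound : Tendsto (fun p : ℕ × ℕ =>
        (1 + K * 𝒞.C₁) * ((2 / c_r) * (|𝒞.Rd m t (g p.1) (J p.1) - 𝒞.Rd m t (g p.2) (J p.2)| +
            |η (min (J p.1) (J p.2))|) + 4 * 𝒞.ℓ₀ * γ' * K * 𝒞.ρ * θ₁ ^ (min (J p.1) (J p.2) - 𝒞.j₀)) +
          2 * K * 𝒞.ρ * θ₁ ^ (min (J p.1) (J p.2) - 𝒞.j₀)) (atTop ×ˢ atTop) (𝓝 0) := by
      have := ((((hD.add hηp).const_mul (2 / c_r)).add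
        (hP.const_mul (4 * 𝒞.ℓ₀ * γ' * K * 𝒞.ρ))).const_mul (1 + K * 𝒞.C₁)).add
        (hP.const_mul (2 * K * 𝒞.ρ))
      simpa using this
    refine squeeze_zero' (Eventually.of_forall fun p => dist_nonneg) ?_ hbound
    filter_upwards [(hA.and hgk).prod_mk (hA.and hgk)] with p hp
    obtain ⟨⟨hA1, hg1⟩, ⟨hA2, hg2⟩⟩ := hp
    exact Reduction.pair_bound 𝒞 hγ'pos hγ'le hK hθ₁0 hc_r hsmall hSk hpin hg1.1 hg2.1 hA1.2.1 hA2.2.1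
      hA1.2.2.1 hA2.2.2.1 hA1.2.2.2.1 hA2.2.2.2.1 hA1.2.2.2.2 hA2.2.2.2.2
  /- the limit point, inside the closed window region -/
  obtain ⟨qs, hqs⟩ := cauchySeq_tendsto_of_complete hcauchy
  have hqW : ∀ᶠ k in atTop, q k ∈ 𝒞.W := by
    filter_upwards [hA] with k hk
    refine Set.mem_prod.2 ⟨⟨(hk.2.2.1 (J k) le_rfl).1, (hk.2.2.1 (J k) le_rfl).2.trans hγ'le⟩, ?_⟩
    rw [Metric.mem_closedBall, dist_zero_right]
    exact hk.2.2.2.1 (J k) hk.2.1 le_rfl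
  have hqsW : qs ∈ 𝒞.W := 𝒞.isClosed_W.mem_of_tendsto hqs hqW
  /- full-sequence convergence on products -/
  intro p _hp f hf
  refine ⟨𝒞.expectInf qs p fun i => (blockDilate M)^[m] (f i), ?_⟩
  have hcont := (𝒞.continuousOn_expect p m f hf).continuousWithinAt hqsW
  have hv : Tendsto (fun k => 𝒞.expectInf (q k) p fun i => (blockDilate M)^[m] (f i)) atTop
      (𝓝 (𝒞.expectInf qs p fun i => (blockDilate M)^[m] (f i))) :=
    hcont.tendsto.comp (tendsto_nhdsWithin_iff.2 ⟨hqs, hqW⟩)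
  refine tendsto_of_forall_eventually_abs_sub_le hv fun ε hε => ?_
  filter_upwards [hvol'.1 p f hf ε hε, hA, hgk] with k hk hAk hg'
  have e1 : (𝒞.expectInf (q k) p fun i => (blockDilate M)^[m] (f i)) =
      𝒞.expectInf (𝒞.orb (g k) 0) p fun i => (blockDilate M)^[n k] (f i) := by
    show 𝒞.expectInf (𝒞.orb (g k) (J k)) p _ = _
    rw [𝒞.expect_iterate hg'.1 (J k) p]
    congr 1
    funext i
    rw [← Function.iterate_add_apply, hAk.1]
  have hlim := 𝒞.expect_wilson (g k) hg'.1 p fun i => (blockDilate M)^[n k] (f i)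
  rw [hg'.2] at hlim
  rw [e1]
  exact abs_sub_le_of_uniform hlim hk

end Engine

/-! ## §2 Gap-free twins of the sibling inputs, and the supplier form of the ∃-stub -/

/-- **`QualFiniteSizeInput` — the rate-free thermodynamic limit at scale, GAP-FREE** (twin of the first conjunct of the sibling
input `IRPhysicsCS`, `…DefsE`, with the idle antecedents `0 < Δ`, `HasLatticeMassGap r sch Δ` deleted): along every tuned
`M`-adic weak-coupling Wilson sequence with convergent towers and polynomial volume growth, `QualFiniteSize r M sch n`
(`…DefsC`: the canonical `p`-point functions on the scheme's torus agree up to `o(1)`, uniformly over all larger tori, with the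
unit-normalised block-dilated Wilson functions; same for the scaled point-split correlators). IR physics; open. -/
def QualFiniteSizeInput : Prop :=
  ∀ (G : Type) [Group G] [TopologicalSpace G] [IsTopologicalGroup G] [CompactSpace G]
    [MeasurableSpace G] [BorelSpace G], IsCompactSimpleLieGroup G →
    ∀ (r : LatticeRep G) (M : ℕ) (θ : ℝ) (sch : SpeciesScheme (YMSpecies G)) (n : ℕ → ℕ),
    0 < θ → (∀ k, sch.a k = ((M : ℝ) ^ n k)⁻¹) → Tendsto sch.β atTop atTop →
    (∀ t : ℕ, 0 < t → ∃ c : ℝ, Tendsto (fun k => ((M : ℝ) ^ n k) ^ 8 *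
      latticeConnectedCorr r.ρ (sch.β k) (sch.side k) r.curvature.F r.curvature.F (t * M ^ n k)) atTop (𝓝 c)) →
    Tendsto (fun k => ((M : ℝ) ^ n k) ^ 8 *
      latticeConnectedCorr r.ρ (sch.β k) (sch.side k) r.curvature.F r.curvature.F (M ^ n k)) atTop (𝓝 θ) →
    PolyVolumeGrowth sch → QualFiniteSize r M sch n

/-- **`UVEngine345` — the volume-uniform UV engine, GAP-FREE** (twin of the sibling input `UVPhysics345`, `…DefsE`, with the
idle antecedents `0 < Δ`, `HasLatticeMassGap r sch Δ` deleted): along every tuned `M`-adic weak-coupling Wilson sequence with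
convergent towers, polynomial volume growth and product-convergent canonical curvature functions: uniform-threshold
plaquette-string bounds `UUVB`, asymptotic invariance under ONE Pythagorean rotation `Rot345`, and the non-degeneracy
witnesses `ND2`, `ND3`. UV physics (Bałaban / Magnen–Rivasseau–Sénéor class, with observables); open. -/
def UVEngine345 : Prop :=
  ∀ (G : Type) [Group G] [TopologicalSpace G] [IsTopologicalGroup G] [CompactSpace G]
    [MeasurableSpace G] [BorelSpace G], IsCompactSimpleLieGroup G →
    ∀ (r : LatticeRep G) (M : ℕ) (θ : ℝ) (sch : SpeciesScheme (YMSpecies G)) (n : ℕ → ℕ),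
    0 < θ → (∀ k, sch.a k = ((M : ℝ) ^ n k)⁻¹) → Tendsto sch.β atTop atTop →
    (∀ t : ℕ, 0 < t → ∃ c : ℝ, Tendsto (fun k => ((M : ℝ) ^ n k) ^ 8 *
      latticeConnectedCorr r.ρ (sch.β k) (sch.side k) r.curvature.F r.curvature.F (t * M ^ n k)) atTop (𝓝 c)) →
    Tendsto (fun k => ((M : ℝ) ^ n k) ^ 8 *
      latticeConnectedCorr r.ρ (sch.β k) (sch.side k) r.curvature.F r.curvature.F (M ^ n k)) atTop (𝓝 θ) →
    PolyVolumeGrowth sch → ConvProducts r sch →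
      UUVB r sch ∧ Rot345 r sch ∧ ND2 r sch ∧ ND3 r sch

/-- **`UVScheme345` — the ∃-stub `stub_uvScheme` with the one-rotation restoration added** (the form every supplier that
delivers a UV package of `UVPhysics345` type reaches): for every compact simple `G`, a faithful lattice representation and a
weak-coupling, polynomially growing scheme with `ConvProducts`, `UUVB`, `Rot345`, `ND2`, `ND3`. -/
def UVScheme345 : Prop :=
  ∀ (G : Type) [Group G] [TopologicalSpace G] [IsTopologicalGroup G] [CompactSpace G]
    [MeasurableSpace G] [BorelSpace G], IsCompactSimpleLieGroup G →
    ∃ (r : LatticeRep G) (sch : SpeciesScheme (YMSpecies G)),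
      sch.HasWeakCouplingLimit ∧ PolyVolumeGrowth sch ∧ ConvProducts r sch ∧ UUVB r sch ∧ Rot345 r sch ∧
        ND2 r sch ∧ ND3 r sch

/-- The gap-free UV twin implies the sibling's gapped input `UVPhysics345` (ignore the gap antecedents): one proof of
`UVEngine345` serves both routes. -/
theorem uvPhysics345_of_uvEngine345 : UVEngine345 → UVPhysics345 :=
  fun h G _ _ _ _ _ _ hG r M θ _Δ sch n hθ _hΔ hshape hβ htower htune _hgap hgrowth hconv =>
    h G hG r M θ sch n hθ hshape hβ htower htune hgrowth hconv

/-- **The ∃-stub through the two-orbit supplier.** `TunedSequenceExistsPVG` ((S_PVG) of route ParabolicTrajectory) ∧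
`ChartExists` (the two-orbit chart) ∧ `QualFiniteSizeInput` ∧ `UVEngine345` imply `UVScheme345`: take any faithful `r`
(`IsCompactSimpleLieGroup`), `M = max M₀ 2` and a chart from `ChartExists`, a tuned sequence at `θ = θ₀/2` from (S_PVG) (it
carries `β_k → ∞` and the volume clause), `QualFiniteSize` from `QualFiniteSizeInput`, `ConvProducts` from
`convProducts_of_chart`, and the UV package from `UVEngine345`. The Borel structure demanded by the stub is identified with
`borel G` (`BorelSpace.measurable_eq`), the one (S_PVG) is stated for. -/
theorem uvScheme345_of_twoOrbit (hS : TunedSequenceExistsPVG) (hchart : ChartExists) (hfs : QualFiniteSizeInput)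
    (huv : UVEngine345) : UVScheme345 := by
  intro G _ _ _ _ inst hB hG
  obtain ⟨hmeas⟩ := hB
  subst hmeas
  letI : MeasurableSpace G := borel G
  haveI : BorelSpace G := ⟨rfl⟩
  obtain ⟨r⟩ := hG.2
  obtain ⟨M₀, hM₀⟩ := hchart G hG r
  have hM2 : 2 ≤ max M₀ 2 := le_max_right _ _
  obtain ⟨𝒞⟩ := hM₀ (max M₀ 2) (le_max_left _ _) hM2
  obtain ⟨θ₀, hθ₀, hS'⟩ := hS G hG r (max M₀ 2) hM2
  obtain ⟨sch, n, hshape, hbeta, htower, htune, hgrowth⟩ := hS' (θ₀ / 2) (half_pos hθ₀) (half_lt_self hθ₀)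
  have hgrowth' : PolyVolumeGrowth sch := hgrowth
  have hvol' : QualFiniteSize r (max M₀ 2) sch n :=
    hfs G hG r (max M₀ 2) (θ₀ / 2) sch n (half_pos hθ₀) hshape hbeta htower htune hgrowth'
  have hconv : ConvProducts r sch := convProducts_of_chart r 𝒞 (half_pos hθ₀) hshape hbeta htower htune hvol'
  obtain ⟨hU, h345, hND2, hND3⟩ :=
    huv G hG r (max M₀ 2) (θ₀ / 2) sch n (half_pos hθ₀) hshape hbeta htower htune hgrowth' hconv
  exact ⟨r, sch, hbeta, hgrowth', hconv, hU, h345, hND2, hND3⟩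

/-- **`stub_uvScheme`'s statement through the two-orbit supplier** (drop `Rot345`): the registered ∃-stub of `Lines/birth.lean`
is closed modulo (S_PVG), the chart, the gap-free finite-size input and the gap-free UV engine. -/
theorem stub_uvScheme_of_twoOrbit (hS : TunedSequenceExistsPVG) (hchart : ChartExists) (hfs : QualFiniteSizeInput)
    (huv : UVEngine345) :
    ∀ (G : Type) [Group G] [TopologicalSpace G] [IsTopologicalGroup G] [CompactSpace G]
      [MeasurableSpace G] [BorelSpace G], IsCompactSimpleLieGroup G →
      ∃ (r : LatticeRep G) (sch : SpeciesScheme (YMSpecies G)),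
        sch.HasWeakCouplingLimit ∧ PolyVolumeGrowth sch ∧ ConvProducts r sch ∧ UUVB r sch ∧
          ND2 r sch ∧ ND3 r sch := by
  intro G _ _ _ _ _ _ hG
  obtain ⟨r, sch, hW, hGr, hconv, hU, -, hND2, hND3⟩ := uvScheme345_of_twoOrbit hS hchart hfs huv G hG
  exact ⟨r, sch, hW, hGr, hconv, hU, hND2, hND3⟩

end Summit.QuantumFields.YangMills.Cruxes.ContinuumLimitExists.Birth

end
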